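import Mathlib
import HarnessLib
import Summits.ValiantsHypothesis.ValiantsHypothesis.Theorems.LacunarySymmetroidMatrixDescartesProductPlusOneRealRootedWindows
import Summits.ValiantsHypothesis.ValiantsHypothesis.Theorems.LacunarySymmetroidMatrixDescartesProductPlusOneCrossingSign

/-!
# LINE (A) `product_plus_one` (crux `MatrixDescartes`, stmt-ValiantsHypothesis-18050, V1) — W-currency, the REAL-ROOTED WINDOW LAW
# (W-CB base cell, all rates equal): `W(P)` has ≤ 2 zeros per inner window and ≤ 1 per outer window for every real-rooted `P`

Owner memo `pub/ideators/val-idea-25/NOTE-idea25g3-18050-LINEA-AB-reduction.md` §17.3/§18.3 (val-idea-25 g4; CLAIM R = the cyclic Descartes rule for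
inverse-square sums in its two-sign-change case), in kernel and in LINE currency.  With `θ = X·d/dX` and the log-Wronskian
`W(P) = P·θ(θP) − (θP)²` (spelled `P * (X * derivative (X * derivative P)) - (X * derivative P) ^ 2`, as in `WronskianBudgetK3`):

* §1 `logWronskian_X_sub_C` (`W(X − a) = −aX`), `logWronskian_C_mul` (`W(c·Q) = c²·W(Q)`), ★ `logWronskian_eval_prod_X_sub_C` /
  `logWronskian_eval_of_splits` — the ROOT-KERNEL DICTIONARY (memo §17 (A1), exact, reusable by every W-cell): for a real-rooted `P`
  (`P.roots.card = P.natDegree`) and `P(x) ≠ 0`, `W(P)(x) = −x·P(x)²·Σ_ρ m_ρ·ρ/(x − ρ)²` (distinct roots `ρ`, multiplicities `m_ρ`; ✓ `logWronskian_mul`);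
* §2 counting shells: `exists_three_ordered`, `card_le_two_of_no_three`, `card_le_one_of_no_two`, `card_le_two_mul_card_add_two` (separator count);
* §3 ★★ THE WINDOW LAW for every real-rooted `P`: `logWronskian_roots_inner_le_two` (≤ 2 roots of `W(P)` in every open interval between consecutive
  positive roots of `P`), `logWronskian_roots_leftOuter_le_one` (≤ 1 in `(0, t_min)`), `logWronskian_roots_rightOuter_le_one` (≤ 1 in `(t_max, ∞)`) —
  by ✓ `rootKernel_inner_no_three_zeros` / `…leftOuter…` / `…rightOuter…` (the integral-free certificate `F″ + σF′ > 0`, resp. `F′ > 0`, `F′ + σF < 0`)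
  — the global count `Z₊(W(P)) ≤ B + B_mult ≤ 2·B_mult` is the separate bookkeeping file `…RealRootedCount`;
* §4 LINE CURRENCY: `realRooted_prod` (a company whose rows are real-rooted has a real-rooted product) and the window law for companies
  `company_logWronskian_roots_inner_le_two` / `…leftOuter_le_one` / `…rightOuter_le_one` (`P = ∏_j Σ_l C (a j l) X^{d l}`, every row real-rooted).

Honest framing (pen §18.2 / crit-6 #53): the window law is the ALL-RATES-EQUAL base case of the W-currency conjecture W-CB, NOT a rung of EB2-W —
real-rooted fewnomial rows are dense (degree ≤ 3 after deflation), so the global count is degree-regime bookkeeping, not evidence for `WronskianBudgetK3`;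
`WronskianBudgetK3` / `OneChangeFloorK3` / `stub_polyLaw` / `MatrixDescartes` / B are NOT proved; `VP ≠ VNP` NOT proved.  No definitions, no named facts;
Mathlib + ✓ lane modules only.
-/

set_option linter.dupNamespace false

namespace Summit.ValiantsHypothesis.ValiantsHypothesis.Theorems.LacunarySymmetroidMatrixDescartes

namespace ProductPlusOne

open Polynomial Finset Set
open scoped BigOperators

/-! ### §1 The root-kernel dictionary `W(P)(x) = −x·P(x)²·Σ m_ρ ρ/(x−ρ)²` -/

/-- `W(X − a) = −a·X`. [folklore] -/
theorem logWronskian_X_sub_C (a : ℝ) :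
    (X - C a) * (X * derivative (X * derivative (X - C a))) - (X * derivative (X - C a)) ^ 2 = -(C a * X) := by
  simp only [derivative_sub, derivative_X, derivative_C, sub_zero, mul_one]
  ring

/-- `W(c·Q) = c²·W(Q)`. [folklore] -/
theorem logWronskian_C_mul (c : ℝ) (Q : ℝ[X]) :
    (C c * Q) * (X * derivative (X * derivative (C c * Q))) - (X * derivative (C c * Q)) ^ 2
      = C c ^ 2 * (Q * (X * derivative (X * derivative Q)) - (X * derivative Q) ^ 2) := by
  rw [logWronskian_mul]
  simp only [derivative_C, mul_zero, derivative_zero, zero_pow (two_ne_zero), sub_zero]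
  ring

/-- ★ **Dictionary for a product of linear factors**: for `x` off the roots,
`W(∏_{ρ∈s} (X − ρ))(x) = −x·(∏(x − ρ))²·Σ_{ρ∈s} ρ/(x − ρ)²` (multiset `s`, repeats allowed). [this file's theorem] -/
theorem logWronskian_eval_prod_X_sub_C (s : Multiset ℝ) (x : ℝ) (hx : ∀ ρ ∈ s, x ≠ ρ) :
    ((s.map (fun ρ => X - C ρ)).prod * (X * derivative (X * derivative (s.map (fun ρ => X - C ρ)).prod))
        - (X * derivative (s.map (fun ρ => X - C ρ)).prod) ^ 2).eval x
      = -x * ((s.map (fun ρ => X - C ρ)).prod.eval x) ^ 2 * (s.map (fun ρ => ρ / (x - ρ) ^ 2)).sum := by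
  induction s using Multiset.induction_on with
  | empty => simp
  | cons a s ih =>
    have hxa : x ≠ a := hx a (Multiset.mem_cons_self a s)
    have hxs : ∀ ρ ∈ s, x ≠ ρ := fun ρ hρ => hx ρ (Multiset.mem_cons_of_mem hρ)
    rw [Multiset.map_cons, Multiset.prod_cons, logWronskian_mul, Multiset.map_cons, Multiset.sum_cons, eval_add, eval_mul,
      eval_mul, eval_pow, eval_pow, ih hxs, logWronskian_X_sub_C, eval_mul]
    simp only [eval_neg, eval_mul, eval_C, eval_X, eval_sub]
    have hc : x - a ≠ 0 := sub_ne_zero.2 hxa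
    field_simp
    ring

/-- ★ **THE ROOT-KERNEL DICTIONARY** for a real-rooted polynomial (`P.roots.card = P.natDegree`): off the roots,
`W(P)(x) = −x·P(x)²·Σ_{ρ} m_ρ·ρ/(x − ρ)²` (distinct roots `ρ`, multiplicities `m_ρ = P.roots.count ρ`). [this file's theorem] -/
theorem logWronskian_eval_of_splits (P : ℝ[X]) (hP : P ≠ 0) (hsplit : Multiset.card P.roots = P.natDegree)
    (x : ℝ) (hx : P.eval x ≠ 0) :
    (P * (X * derivative (X * derivative P)) - (X * derivative P) ^ 2).eval x
      = -x * (P.eval x) ^ 2 * ∑ ρ ∈ P.roots.toFinset, (P.roots.count ρ : ℝ) * ρ / (x - ρ) ^ 2 := by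
  classical
  have hxr : ∀ ρ ∈ P.roots, x ≠ ρ := by
    intro ρ hρ hxρ
    exact hx (by rw [hxρ]; exact (mem_roots hP).1 hρ)
  have hprod := C_leadingCoeff_mul_prod_multiset_X_sub_C hsplit
  have hPx : P.eval x = P.leadingCoeff * ((P.roots.map fun a => X - C a).prod).eval x := by
    conv_lhs => rw [← hprod]
    rw [eval_mul, eval_C]
  conv_lhs => rw [← hprod]
  rw [logWronskian_C_mul, eval_mul, eval_pow, eval_C, logWronskian_eval_prod_X_sub_C _ x hxr,
    Finset.sum_multiset_map_count, hPx]
  have hsum : ∑ ρ ∈ P.roots.toFinset, P.roots.count ρ • (ρ / (x - ρ) ^ 2)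
      = ∑ ρ ∈ P.roots.toFinset, (P.roots.count ρ : ℝ) * ρ / (x - ρ) ^ 2 :=
    Finset.sum_congr rfl fun ρ _ => by rw [nsmul_eq_mul, mul_div_assoc]
  rw [hsum]
  ring

/-! ### §2 Counting shells -/

/-- Three elements of a finite set of reals can be listed increasingly. [folklore] -/
theorem exists_three_ordered (T : Finset ℝ) (h : 2 < T.card) :
    ∃ x ∈ T, ∃ y ∈ T, ∃ z ∈ T, x < y ∧ y < z := by
  classical
  have hne : T.Nonempty := Finset.card_pos.1 (show 0 < T.card by omega)
  set x := T.min' hne with hx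
  set z := T.max' hne with hz
  have hxT : x ∈ T := Finset.min'_mem T hne
  have hzT : z ∈ T := Finset.max'_mem T hne
  have hcard : 0 < ((T.erase x).erase z).card := by
    have h1 : (T.erase x).card = T.card - 1 := Finset.card_erase_of_mem hxT
    have h2 : ((T.erase x).erase z).card ≥ (T.erase x).card - 1 := by
      rw [ge_iff_le]
      exact Finset.pred_card_le_card_erase
    omega
  obtain ⟨y, hy⟩ := Finset.card_pos.1 hcard
  have hyz : y ≠ z := Finset.ne_of_mem_erase hy
  have hy' : y ∈ T.erase x := Finset.mem_of_mem_erase hy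
  have hyx : y ≠ x := Finset.ne_of_mem_erase hy'
  have hyT : y ∈ T := Finset.mem_of_mem_erase hy'
  refine ⟨x, hxT, y, hyT, z, hzT, lt_of_le_of_ne (Finset.min'_le T y hyT) (Ne.symm hyx),
    lt_of_le_of_ne (Finset.le_max' T y hyT) hyz⟩

/-- A finite set of reals with no three increasing elements has at most two elements. [folklore] -/
theorem card_le_two_of_no_three (T : Finset ℝ) (h : ∀ x ∈ T, ∀ y ∈ T, ∀ z ∈ T, x < y → y < z → False) :
    T.card ≤ 2 := by
  by_contra hlt
  obtain ⟨x, hx, y, hy, z, hz, hxy, hyz⟩ := exists_three_ordered T (show 2 < T.card by omega)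
  exact h x hx y hy z hz hxy hyz

/-- A finite set of reals with no two increasing elements has at most one element. [folklore] -/
theorem card_le_one_of_no_two (T : Finset ℝ) (h : ∀ x ∈ T, ∀ y ∈ T, x < y → False) : T.card ≤ 1 := by
  by_contra hlt
  obtain ⟨x, hx, y, hy, hxy⟩ := Finset.one_lt_card.1 (show 1 < T.card by omega)
  rcases lt_or_gt_of_ne hxy with hlt' | hgt
  · exact h x hx y hy hlt'
  · exact h y hy x hx hgt

/-- **Separator count**: if between the extremes of ANY THREE points of `T` lies a point of `R`, and `T` avoids `R`, then
`|T| ≤ 2·|R| + 2`. [folklore] -/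
theorem card_le_two_mul_card_add_two (T R : Finset ℝ) (hdisj : ∀ t ∈ T, t ∉ R)
    (h : ∀ x ∈ T, ∀ y ∈ T, ∀ z ∈ T, x < y → y < z → ∃ r ∈ R, x < r ∧ r < z) :
    T.card ≤ 2 * R.card + 2 := by
  classical
  induction R using Finset.induction_on_max generalizing T with
  | empty =>
    simp only [Finset.card_empty, mul_zero, zero_add]
    refine card_le_two_of_no_three T fun x hx y hy z hz hxy hyz => ?_
    obtain ⟨r, hr, -⟩ := h x hx y hy z hz hxy hyz
    simp at hr
  | insert a S hS ih =>
    have haS : a ∉ S := fun ha => lt_irrefl a (hS a ha)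
    rw [Finset.card_insert_of_notMem haS]
    -- split `T` at `a` (no element of `T` equals `a`)
    have hsplit := Finset.card_filter_add_card_filter_not (s := T) (fun t : ℝ => t < a)
    have hlo : (T.filter (fun t => t < a)).card ≤ 2 * S.card + 2 := by
      refine ih (T.filter (fun t => t < a)) (fun t ht htS => ?_) (fun x hx y hy z hz hxy hyz => ?_)
      · exact hdisj t (Finset.mem_of_mem_filter t ht) (Finset.mem_insert_of_mem htS)
      · obtain ⟨r, hr, hxr, hrz⟩ := h x (Finset.mem_of_mem_filter x hx) y (Finset.mem_of_mem_filter y hy)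
          z (Finset.mem_of_mem_filter z hz) hxy hyz
        have hza : z < a := (Finset.mem_filter.1 hz).2
        rcases Finset.mem_insert.1 hr with rfl | hrS
        · exact absurd (hrz.trans hza) (lt_irrefl _)
        · exact ⟨r, hrS, hxr, hrz⟩
    have hhi : (T.filter (fun t => ¬ t < a)).card ≤ 2 := by
      refine card_le_two_of_no_three _ fun x hx y hy z hz hxy hyz => ?_
      have hxT := Finset.mem_of_mem_filter x hx
      have hxa : a < x := by
        rcases lt_or_eq_of_le (not_lt.1 (Finset.mem_filter.1 hx).2) with hlt | heq
        · exact hlt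
        · exact absurd (Finset.mem_insert_self a S) (heq ▸ hdisj x hxT)
      obtain ⟨r, hr, hxr, -⟩ := h x hxT y (Finset.mem_of_mem_filter y hy) z (Finset.mem_of_mem_filter z hz) hxy hyz
      rcases Finset.mem_insert.1 hr with rfl | hrS
      · exact absurd (hxa.trans hxr) (lt_irrefl _)
      · exact absurd ((hS r hrS).trans (hxa.trans hxr)) (lt_irrefl _)
    omega

/-! ### §3 The window law for real-rooted polynomials, and the global count -/

/-- ★★ **WINDOW LAW, inner window**: for a real-rooted `P` and consecutive positive roots `a < b` (no root of `P` strictly between),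
`W(P) = P·θ(θP) − (θP)²` has at most TWO roots in `(a, b)`. [this file's theorem] -/
theorem logWronskian_roots_inner_le_two (P : ℝ[X]) (hsplit : Multiset.card P.roots = P.natDegree) {a b : ℝ} (ha0 : 0 < a) (hab : a < b)
    (ha : P.IsRoot a) (hb : P.IsRoot b) (hno : ∀ t, a < t → t < b → ¬ P.IsRoot t) :
    ((P * (X * derivative (X * derivative P)) - (X * derivative P) ^ 2).roots.toFinset.filter (fun t => a < t ∧ t < b)).card ≤ 2 := by
  classical
  set W : ℝ[X] := P * (X * derivative (X * derivative P)) - (X * derivative P) ^ 2 with hWdef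
  by_cases hW : W = 0
  · have : (W.roots.toFinset.filter (fun t => a < t ∧ t < b)) = ∅ := by
      rw [hW, roots_zero, Multiset.toFinset_zero, Finset.filter_empty]
    rw [this, Finset.card_empty]; exact Nat.zero_le _
  have hP : P ≠ 0 := by
    rintro rfl
    exact hW (by rw [hWdef]; simp)
  have hwpos : ∀ ρ ∈ P.roots.toFinset, 0 < (fun ρ => (P.roots.count ρ : ℝ)) ρ := fun ρ hρ => by
    show (0 : ℝ) < (P.roots.count ρ : ℝ)
    exact_mod_cast Multiset.count_pos.2 (Multiset.mem_toFinset.1 hρ)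
  -- a root of `W` in the window is off the roots of `P`, hence a zero of the root kernel
  have hzero : ∀ t ∈ W.roots.toFinset.filter (fun t => a < t ∧ t < b),
      (a < t ∧ t < b) ∧ ∑ ρ ∈ P.roots.toFinset, (P.roots.count ρ : ℝ) * ρ / (t - ρ) ^ 2 = 0 := by
    intro t ht
    rw [Finset.mem_filter, Multiset.mem_toFinset, mem_roots hW, IsRoot.def] at ht
    obtain ⟨hWt, hat, htb⟩ := ht
    have hPt : P.eval t ≠ 0 := fun h => hno t hat htb h
    refine ⟨⟨hat, htb⟩, ?_⟩
    rw [logWronskian_eval_of_splits P hP hsplit t hPt] at hWt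
    have h1 : -t * (P.eval t) ^ 2 ≠ 0 := mul_ne_zero (neg_ne_zero.2 (ne_of_gt (ha0.trans hat))) (pow_ne_zero 2 hPt)
    exact (mul_eq_zero.1 hWt).resolve_left h1
  have haroot : a ∈ P.roots.toFinset := by rw [Multiset.mem_toFinset, mem_roots hP]; exact ha
  have hbroot : b ∈ P.roots.toFinset := by rw [Multiset.mem_toFinset, mem_roots hP]; exact hb
  have hwindow : ∀ ρ ∈ P.roots.toFinset, ρ ≤ a ∨ b ≤ ρ := by
    intro ρ hρ
    have hρroot : P.IsRoot ρ := (mem_roots hP).1 (Multiset.mem_toFinset.1 hρ)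
    by_contra hcon
    push Not at hcon
    exact hno ρ hcon.1 hcon.2 hρroot
  refine card_le_two_of_no_three _ fun x hx y hy z hz hxy hyz => ?_
  obtain ⟨⟨hax, hxb⟩, hFx⟩ := hzero x hx
  obtain ⟨_, hFy⟩ := hzero y hy
  obtain ⟨⟨haz, hzb⟩, hFz⟩ := hzero z hz
  exact rootKernel_inner_no_three_zeros P.roots.toFinset (fun ρ => (P.roots.count ρ : ℝ)) (fun ρ => ρ) hwpos ha0 hab hwindow
    ⟨a, haroot, ha0, le_rfl⟩ ⟨b, hbroot, le_rfl⟩ ⟨hax, hxb⟩ ⟨haz, hzb⟩ hxy hyz hFx hFy hFz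

/-- ★★ **WINDOW LAW, left outer window**: for a real-rooted `P` with least positive root `b` (no root of `P` in `(0, b)`), `W(P)` has at most
ONE root in `(0, b)`. [this file's theorem] -/
theorem logWronskian_roots_leftOuter_le_one (P : ℝ[X]) (hsplit : Multiset.card P.roots = P.natDegree) {b : ℝ} (hb0 : 0 < b)
    (hb : P.IsRoot b) (hno : ∀ t, 0 < t → t < b → ¬ P.IsRoot t) :
    ((P * (X * derivative (X * derivative P)) - (X * derivative P) ^ 2).roots.toFinset.filter (fun t => 0 < t ∧ t < b)).card ≤ 1 := by
  classical
  set W : ℝ[X] := P * (X * derivative (X * derivative P)) - (X * derivative P) ^ 2 with hWdef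
  by_cases hW : W = 0
  · have : (W.roots.toFinset.filter (fun t => 0 < t ∧ t < b)) = ∅ := by
      rw [hW, roots_zero, Multiset.toFinset_zero, Finset.filter_empty]
    rw [this, Finset.card_empty]; exact Nat.zero_le _
  have hP : P ≠ 0 := by
    rintro rfl
    exact hW (by rw [hWdef]; simp)
  have hwpos : ∀ ρ ∈ P.roots.toFinset, 0 < (fun ρ => (P.roots.count ρ : ℝ)) ρ := fun ρ hρ => by
    show (0 : ℝ) < (P.roots.count ρ : ℝ)
    exact_mod_cast Multiset.count_pos.2 (Multiset.mem_toFinset.1 hρ)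
  have hzero : ∀ t ∈ W.roots.toFinset.filter (fun t => 0 < t ∧ t < b),
      (0 < t ∧ t < b) ∧ ∑ ρ ∈ P.roots.toFinset, (P.roots.count ρ : ℝ) * ρ / (t - ρ) ^ 2 = 0 := by
    intro t ht
    rw [Finset.mem_filter, Multiset.mem_toFinset, mem_roots hW, IsRoot.def] at ht
    obtain ⟨hWt, h0t, htb⟩ := ht
    have hPt : P.eval t ≠ 0 := fun h => hno t h0t htb h
    refine ⟨⟨h0t, htb⟩, ?_⟩
    rw [logWronskian_eval_of_splits P hP hsplit t hPt] at hWt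
    have h1 : -t * (P.eval t) ^ 2 ≠ 0 := mul_ne_zero (neg_ne_zero.2 (ne_of_gt h0t)) (pow_ne_zero 2 hPt)
    exact (mul_eq_zero.1 hWt).resolve_left h1
  have hbroot : b ∈ P.roots.toFinset := by rw [Multiset.mem_toFinset, mem_roots hP]; exact hb
  have hwindow : ∀ ρ ∈ P.roots.toFinset, ρ ≤ 0 ∨ b ≤ ρ := by
    intro ρ hρ
    have hρroot : P.IsRoot ρ := (mem_roots hP).1 (Multiset.mem_toFinset.1 hρ)
    by_contra hcon
    push Not at hcon
    exact hno ρ hcon.1 hcon.2 hρroot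
  refine card_le_one_of_no_two _ fun x hx y hy hxy => ?_
  obtain ⟨hxI, hFx⟩ := hzero x hx
  obtain ⟨hyI, hFy⟩ := hzero y hy
  exact rootKernel_leftOuter_no_two_zeros P.roots.toFinset (fun ρ => (P.roots.count ρ : ℝ)) (fun ρ => ρ) hwpos hb0 hwindow
    ⟨b, hbroot, ne_of_gt hb0⟩ hxI hyI hxy hFx hFy

/-- ★★ **WINDOW LAW, right outer window**: for a real-rooted `P` with largest positive root `a` (no root of `P` in `(a, ∞)`), `W(P)` has at most
ONE root in `(a, ∞)`. [this file's theorem] -/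
theorem logWronskian_roots_rightOuter_le_one (P : ℝ[X]) (hsplit : Multiset.card P.roots = P.natDegree) {a : ℝ} (ha0 : 0 < a)
    (ha : P.IsRoot a) (hno : ∀ t, a < t → ¬ P.IsRoot t) :
    ((P * (X * derivative (X * derivative P)) - (X * derivative P) ^ 2).roots.toFinset.filter (fun t => a < t)).card ≤ 1 := by
  classical
  set W : ℝ[X] := P * (X * derivative (X * derivative P)) - (X * derivative P) ^ 2 with hWdef
  by_cases hW : W = 0
  · have : (W.roots.toFinset.filter (fun t => a < t)) = ∅ := by
      rw [hW, roots_zero, Multiset.toFinset_zero, Finset.filter_empty]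
    rw [this, Finset.card_empty]; exact Nat.zero_le _
  have hP : P ≠ 0 := by
    rintro rfl
    exact hW (by rw [hWdef]; simp)
  have hwpos : ∀ ρ ∈ P.roots.toFinset, 0 < (fun ρ => (P.roots.count ρ : ℝ)) ρ := fun ρ hρ => by
    show (0 : ℝ) < (P.roots.count ρ : ℝ)
    exact_mod_cast Multiset.count_pos.2 (Multiset.mem_toFinset.1 hρ)
  have hzero : ∀ t ∈ W.roots.toFinset.filter (fun t => a < t),
      a < t ∧ ∑ ρ ∈ P.roots.toFinset, (P.roots.count ρ : ℝ) * ρ / (t - ρ) ^ 2 = 0 := by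
    intro t ht
    rw [Finset.mem_filter, Multiset.mem_toFinset, mem_roots hW, IsRoot.def] at ht
    obtain ⟨hWt, hat⟩ := ht
    have hPt : P.eval t ≠ 0 := fun h => hno t hat h
    refine ⟨hat, ?_⟩
    rw [logWronskian_eval_of_splits P hP hsplit t hPt] at hWt
    have h1 : -t * (P.eval t) ^ 2 ≠ 0 := mul_ne_zero (neg_ne_zero.2 (ne_of_gt (ha0.trans hat))) (pow_ne_zero 2 hPt)
    exact (mul_eq_zero.1 hWt).resolve_left h1
  have haroot : a ∈ P.roots.toFinset := by rw [Multiset.mem_toFinset, mem_roots hP]; exact ha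
  have hwindow : ∀ ρ ∈ P.roots.toFinset, ρ ≤ a := by
    intro ρ hρ
    have hρroot : P.IsRoot ρ := (mem_roots hP).1 (Multiset.mem_toFinset.1 hρ)
    by_contra hcon
    push Not at hcon
    exact hno ρ hcon hρroot
  refine card_le_one_of_no_two _ fun x hx y hy hxy => ?_
  obtain ⟨hxI, hFx⟩ := hzero x hx
  obtain ⟨hyI, hFy⟩ := hzero y hy
  exact rootKernel_rightOuter_no_two_zeros P.roots.toFinset (fun ρ => (P.roots.count ρ : ℝ)) (fun ρ => ρ) hwpos ha0 hwindow
    ⟨a, haroot, ha0⟩ hxI hyI hxy hFx hFy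

/-! ### §4 LINE currency: companies whose rows are real-rooted -/

/-- A product of nonzero real-rooted polynomials is real-rooted. [folklore] -/
theorem realRooted_prod {m : ℕ} (f : Fin m → ℝ[X]) (hf : ∀ j, f j ≠ 0)
    (hreal : ∀ j, Multiset.card (f j).roots = (f j).natDegree) :
    Multiset.card (∏ j, f j).roots = (∏ j, f j).natDegree := by
  classical
  have hP : ∏ j, f j ≠ 0 := Finset.prod_ne_zero_iff.2 fun j _ => hf j
  rw [roots_prod _ _ hP, Multiset.card_bind, natDegree_prod _ _ (fun j _ => hf j), Finset.sum_eq_multiset_sum]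
  congr 1
  exact Multiset.map_congr rfl fun j _ => hreal j

/-- ★★ **WINDOW LAW FOR COMPANIES, inner window** (LINE currency): if every row `Σ_l C (a j l) X^{d l}` of a company is real-rooted, then between two
consecutive positive roots `a < b` of the product `P` the log-Wronskian `W(P)` has at most TWO roots. [this file's theorem] -/
theorem company_logWronskian_roots_inner_le_two {m K : ℕ} (d : Fin K → ℕ) (a : Fin m → Fin K → ℝ)
    (hreal : ∀ j, Multiset.card (∑ l, C (a j l) * X ^ (d l) : ℝ[X]).roots = (∑ l, C (a j l) * X ^ (d l) : ℝ[X]).natDegree)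
    {u v : ℝ} (hu0 : 0 < u) (huv : u < v) (hu : (∏ j, ∑ l, C (a j l) * X ^ (d l) : ℝ[X]).IsRoot u)
    (hv : (∏ j, ∑ l, C (a j l) * X ^ (d l) : ℝ[X]).IsRoot v)
    (hno : ∀ t, u < t → t < v → ¬ (∏ j, ∑ l, C (a j l) * X ^ (d l) : ℝ[X]).IsRoot t) :
    (((∏ j, ∑ l, C (a j l) * X ^ (d l)) * (X * derivative (X * derivative (∏ j, ∑ l, C (a j l) * X ^ (d l))))
        - (X * derivative (∏ j, ∑ l, C (a j l) * X ^ (d l))) ^ 2 : ℝ[X]).roots.toFinset.filter (fun t => u < t ∧ t < v)).card ≤ 2 := by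
  classical
  by_cases hP : (∏ j, ∑ l, C (a j l) * X ^ (d l) : ℝ[X]) = 0
  · rw [hP]; simp
  have hf : ∀ j, (∑ l, C (a j l) * X ^ (d l) : ℝ[X]) ≠ 0 := fun j hj =>
    hP (Finset.prod_eq_zero (Finset.mem_univ j) hj)
  exact logWronskian_roots_inner_le_two _ (realRooted_prod _ hf hreal) hu0 huv hu hv hno

/-- ★★ **WINDOW LAW FOR COMPANIES, left outer window**: rows real-rooted, `v` the least positive root of the product ⇒ `W(P)` has at most ONE
root in `(0, v)`. [this file's theorem] -/
theorem company_logWronskian_roots_leftOuter_le_one {m K : ℕ} (d : Fin K → ℕ) (a : Fin m → Fin K → ℝ)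
    (hreal : ∀ j, Multiset.card (∑ l, C (a j l) * X ^ (d l) : ℝ[X]).roots = (∑ l, C (a j l) * X ^ (d l) : ℝ[X]).natDegree)
    {v : ℝ} (hv0 : 0 < v) (hv : (∏ j, ∑ l, C (a j l) * X ^ (d l) : ℝ[X]).IsRoot v)
    (hno : ∀ t, 0 < t → t < v → ¬ (∏ j, ∑ l, C (a j l) * X ^ (d l) : ℝ[X]).IsRoot t) :
    (((∏ j, ∑ l, C (a j l) * X ^ (d l)) * (X * derivative (X * derivative (∏ j, ∑ l, C (a j l) * X ^ (d l))))
        - (X * derivative (∏ j, ∑ l, C (a j l) * X ^ (d l))) ^ 2 : ℝ[X]).roots.toFinset.filter (fun t => 0 < t ∧ t < v)).card ≤ 1 := by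
  classical
  by_cases hP : (∏ j, ∑ l, C (a j l) * X ^ (d l) : ℝ[X]) = 0
  · rw [hP]; simp
  have hf : ∀ j, (∑ l, C (a j l) * X ^ (d l) : ℝ[X]) ≠ 0 := fun j hj =>
    hP (Finset.prod_eq_zero (Finset.mem_univ j) hj)
  exact logWronskian_roots_leftOuter_le_one _ (realRooted_prod _ hf hreal) hv0 hv hno

/-- ★★ **WINDOW LAW FOR COMPANIES, right outer window**: rows real-rooted, `u` the largest positive root of the product ⇒ `W(P)` has at most ONE
root in `(u, ∞)`. [this file's theorem] -/
theorem company_logWronskian_roots_rightOuter_le_one {m K : ℕ} (d : Fin K → ℕ) (a : Fin m → Fin K → ℝ)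
    (hreal : ∀ j, Multiset.card (∑ l, C (a j l) * X ^ (d l) : ℝ[X]).roots = (∑ l, C (a j l) * X ^ (d l) : ℝ[X]).natDegree)
    {u : ℝ} (hu0 : 0 < u) (hu : (∏ j, ∑ l, C (a j l) * X ^ (d l) : ℝ[X]).IsRoot u)
    (hno : ∀ t, u < t → ¬ (∏ j, ∑ l, C (a j l) * X ^ (d l) : ℝ[X]).IsRoot t) :
    (((∏ j, ∑ l, C (a j l) * X ^ (d l)) * (X * derivative (X * derivative (∏ j, ∑ l, C (a j l) * X ^ (d l))))
        - (X * derivative (∏ j, ∑ l, C (a j l) * X ^ (d l))) ^ 2 : ℝ[X]).roots.toFinset.filter (fun t => u < t)).card ≤ 1 := by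
  classical
  by_cases hP : (∏ j, ∑ l, C (a j l) * X ^ (d l) : ℝ[X]) = 0
  · rw [hP]; simp
  have hf : ∀ j, (∑ l, C (a j l) * X ^ (d l) : ℝ[X]) ≠ 0 := fun j hj =>
    hP (Finset.prod_eq_zero (Finset.mem_univ j) hj)
  exact logWronskian_roots_rightOuter_le_one _ (realRooted_prod _ hf hreal) hu0 hu hno

end ProductPlusOne

end Summit.ValiantsHypothesis.ValiantsHypothesis.Theorems.LacunarySymmetroidMatrixDescartes
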